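import Literature.Combinatorics.Optimization.PerfectMatchingPolytopeDimension
import Literature.Combinatorics.Optimization.SDPFormulationMatchingSlack
import HarnessLib

/-!
# Exact SDP formulations of the perfect matching problem `PM_n` have size at least `C(n,2) − n + 1`
# (the Gouveia–Robinson–Thomas dimension bound through the SDP factorization theorem) — PROVED

Sources. G. Braun, J. Brown-Cohen, A. Huq, S. Pokutta, P. Raghavendra, A. Roy, B. Weitz, D. Zink,
*The matching problem has no small symmetric SDP*, Math. Program. 165 (2017) 643–662 = SODA 2016
[BraunEtAl2016]: Definition 2.2 (SDP formulations of a maximization problem, p. 5), Lemma 2.3 (the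
factorization theorem of Braun–Pokutta–Zink [BraunPokuttaZink2015], p. 5), §4 (the perfect matching
problem `PM_n`: feasible solutions the perfect matchings of `K_n`, objectives `f_F(M) = |M ∩ F|` for
edge sets `F`, p. 7), §1 (p. 3: "whether the matching problem has a small SDP remains open").
J. Gouveia, R. Z. Robinson, R. R. Thomas [GouveiaRobinsonThomas2013], Prop. 3.2 (p07) = FGPRT
[FawziEtAl2015] Cor. 5.9 (p15): `rank_psd(S_P) ≥ dim P + 1`.

Everything used is a theorem of the tree: `SDPFormulation (pmProblem n ε) d`,
`SDPFormulation.exists_posSemidef_slack_of_attained`, `SDPFormulation.exists_hasPsdFactorization_pmOddCutSlack`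
(`SymmetricSDPMatching.lean`, `SDPFormulationMatchingSlack.lean`) and the dimension bound for Edmonds'
full slack matrix `PMPolytopeDim.choose_two_sub_add_one_le_of_hasPsdFactorization`
(`PerfectMatchingPolytopeDimension.lean`: `rank_psd(pmFullSlack n) ≥ C(n,2) − n + 1 = dim P_PM(K_n) + 1`).

This file PROVES (no named fact):
* `allButEdge e` — the objective index `F = E(K_n) ∖ {e}`; `pmVal_allButEdge` (`f_{E∖e}(M) = n/2 − χ_M(e)`),
  `pmMax_allButEdge` (`max f_{E∖e} = n/2` for `n ≥ 4`: some perfect matching avoids `e`),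
  `pmSlack_allButEdge`: the slack `C̃(f_{E∖e}) − f_{E∖e}(M)` is the EDGE ROW `χ_M(e)` of Edmonds' slack
  matrix (as `f_{E[U]}` gives half the odd-cut row, [BraunEtAl2016, §4.5]);
* `hasPsdFactorization_pmFullSlack_of_sdpFormulation` — an exact (`ε = 0`) SDP formulation of `PM_n`
  of size `d` gives a psd factorization of size `d` of the FULL slack matrix `pmFullSlack n` (odd-cut
  rows ⊕ edge rows), with the formulation's own `X^M` as column factors;
* **`choose_two_sub_add_one_le_sdp_size`** — for even `n ≥ 4`, every exact SDP formulation of `PM_n`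
  has size `d ≥ C(n,2) − n + 1`; `isEmpty_sdpFormulation_pmProblem` — none of size `≤ C(n,2) − n`.

Honest placement. Label: instrument. This is the classical dimension bound (quadratic in `n`), read in
the SDP-formulation language of the cell's crux; it is stronger than the counting bound
`d(d+1)/2 ≥ dim P` (`d ≳ n`) but polynomial, uses no symmetry (contrast the exponential bound for
symmetric formulations, `BraunEtAl2016_symmetricSDP_matching_holds`), and says nothing about
approximate (`ε > 0`) formulations, whose slack matrices are entrywise positive and to which neither
fooling sets nor the facet flag apply. The general question (super-polynomial SDP size for matching,
`Summit.PneNP.MatchingPsdRank.MatchingPsdRankStretchedExp`) is open; no P-vs-NP content.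

presearch (2026-08-28): an explicit statement "exact SDP formulations of matching need size
≥ dim + 1" is not printed as such (it is GRT Prop. 3.2 + the factorization theorem; corpus fts/hybrid
"semidefinite extension complexity matching polytope dimension", galaxy — nothing beyond the sources
above); recorded as an instantiation of the cited theorems, not as a new result.
-/


noncomputable section

open Finset Matrix

namespace Literature.Combinatorics.Optimization

namespace PMPolytopeDim

open Literature.Barriers.PneNP

variable {n : ℕ}

/-- A perfect matching of `K_n` has `n/2` edges: `2|M| = n`. [folklore] -/
private theorem two_mul_card_pmatch (M : PMatch n) : 2 * M.1.card = n := by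
  classical
  have h := M.2.card_eq_sum_cutCount (subset_refl _)
  rw [Finset.card_univ, Fintype.card_fin] at h
  have h2 : ∑ e ∈ M.1, cutCount (Finset.univ : Finset (Fin n)) e = ∑ e ∈ M.1, 2 := by
    refine Finset.sum_congr rfl fun e _ => ?_
    induction e using Sym2.ind with
    | h a b => simp [cutCount]
  rw [h2, Finset.sum_const, smul_eq_mul] at h
  omega

/-- The objective index "all edges of `K_n` except `e`": `F_e = E(K_n) ∖ {e}`.
[cite: BraunEtAl2016, §4 (p. 7: objectives `f_F`, `F ⊆ E(K_n)`)] -/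
def allButEdge (e : Edge n) : EdgeSet n :=
  ⟨(Finset.univ.filter fun f : Sym2 (Fin n) => ¬f.IsDiag).erase e.1,
    fun _ hf => (Finset.mem_filter.1 (Finset.mem_of_mem_erase hf)).2⟩

/-- `f_{E ∖ e}(M) = |M| − 1[e ∈ M] = n/2 − χ_M(e)`. [cite: BraunEtAl2016, §4 (p. 7)] -/
theorem pmVal_allButEdge (e : Edge n) (M : PMatch n) :
    pmVal (allButEdge e) M = (n : ℝ) / 2 - pmVec n M e := by
  classical
  have hsub : M.1 ⊆ Finset.univ.filter fun f : Sym2 (Fin n) => ¬f.IsDiag := fun f hf =>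
    Finset.mem_filter.2 ⟨Finset.mem_univ _, M.2.not_isDiag hf⟩
  have hinter : M.1 ∩ (allButEdge e).edges = M.1.erase e.1 := by
    ext f
    simp only [allButEdge, Finset.mem_inter, Finset.mem_erase]
    constructor
    · rintro ⟨hf, hne, -⟩; exact ⟨hne, hf⟩
    · rintro ⟨hne, hf⟩; exact ⟨hf, hne, hsub hf⟩
  have hcard : (M.1.card : ℝ) = (n : ℝ) / 2 := by
    have h := two_mul_card_pmatch M
    have h' : (2 : ℝ) * M.1.card = n := by exact_mod_cast h
    linarith
  unfold pmVal
  rw [hinter, pmVec_apply]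
  by_cases he : e.1 ∈ M.1
  · rw [Finset.card_erase_of_mem he, if_pos he, Nat.cast_sub (Finset.card_pos.2 ⟨_, he⟩), hcard]
    norm_num
  · rw [Finset.erase_eq_of_notMem he, if_neg he, hcard, sub_zero]

/-- For `n ≥ 4` every edge of `K_n` is avoided by some perfect matching (if there is one at all).
[folklore] -/
private theorem exists_pmatch_not_mem (h4 : 4 ≤ n) (M₀ : PMatch n) (e : Edge n) :
    ∃ M : PMatch n, e.1 ∉ M.1 := by
  classical
  have hn : Even n := by
    have h := two_mul_card_pmatch M₀
    exact ⟨M₀.1.card, by omega⟩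
  obtain ⟨e, he⟩ := e
  induction e using Sym2.ind with
  | h a b =>
    have hab : a ≠ b := fun h => he (Sym2.mk_isDiag_iff.2 h)
    -- two further vertices
    obtain ⟨c, hca, hcb⟩ : ∃ c : Fin n, c ≠ a ∧ c ≠ b := by
      by_cases h0 : (a : ℕ) ≠ 0 ∧ (b : ℕ) ≠ 0
      · exact ⟨⟨0, by omega⟩, fun h => h0.1 (by rw [← h]), fun h => h0.2 (by rw [← h])⟩
      by_cases h1 : (a : ℕ) ≠ 1 ∧ (b : ℕ) ≠ 1
      · exact ⟨⟨1, by omega⟩, fun h => h1.1 (by rw [← h]), fun h => h1.2 (by rw [← h])⟩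
      · refine ⟨⟨2, by omega⟩, fun h => ?_, fun h => ?_⟩
        · have := congrArg Fin.val h; simp at this; omega
        · have := congrArg Fin.val h; simp at this; omega
    obtain ⟨d, hda, hdb, hdc⟩ : ∃ d : Fin n, d ≠ a ∧ d ≠ b ∧ d ≠ c := by
      have key : ∀ x y z : Fin n, ∃ d : Fin n, d ≠ x ∧ d ≠ y ∧ d ≠ z := by
        intro x y z
        by_cases h0 : (x : ℕ) ≠ 0 ∧ (y : ℕ) ≠ 0 ∧ (z : ℕ) ≠ 0
        · exact ⟨⟨0, by omega⟩, fun h => h0.1 (by rw [← h]), fun h => h0.2.1 (by rw [← h]),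
            fun h => h0.2.2 (by rw [← h])⟩
        by_cases h1 : (x : ℕ) ≠ 1 ∧ (y : ℕ) ≠ 1 ∧ (z : ℕ) ≠ 1
        · exact ⟨⟨1, by omega⟩, fun h => h1.1 (by rw [← h]), fun h => h1.2.1 (by rw [← h]),
            fun h => h1.2.2 (by rw [← h])⟩
        by_cases h2 : (x : ℕ) ≠ 2 ∧ (y : ℕ) ≠ 2 ∧ (z : ℕ) ≠ 2
        · exact ⟨⟨2, by omega⟩, fun h => h2.1 (by rw [← h]), fun h => h2.2.1 (by rw [← h]),
            fun h => h2.2.2 (by rw [← h])⟩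
        · refine ⟨⟨3, by omega⟩, fun h => ?_, fun h => ?_, fun h => ?_⟩
          · have := congrArg Fin.val h; simp at this; omega
          · have := congrArg Fin.val h; simp at this; omega
          · have := congrArg Fin.val h; simp at this; omega
      exact key a b c
    -- a perfect matching containing `ac` and `bd`
    set S : Finset (Fin n) := Finset.univ \ {a, c, b, d} with hS
    have hScard : S.card = n - 4 := by
      rw [hS, Finset.card_sdiff_of_subset (Finset.subset_univ _), Finset.card_univ, Fintype.card_fin]
      rw [Finset.card_insert_of_notMem (by simp [hca.symm, hab, hda.symm]),
        Finset.card_insert_of_notMem (by simp [hcb, hdc.symm]), Finset.card_pair hdb.symm]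
    have hSeven : Even (n - 4) := by obtain ⟨k, hk⟩ := hn; exact ⟨k - 2, by omega⟩
    obtain ⟨M₁, hM₁⟩ := exists_isPMOn_of_even (n - 4) S hScard hSeven
    have hd1 : Disjoint ({b, d} : Finset (Fin n)) S := by
      rw [hS, Finset.disjoint_left]; intro x hx
      simp only [Finset.mem_insert, Finset.mem_singleton] at hx
      rcases hx with rfl | rfl <;> simp
    have hbdS : IsPMOn ({b, d} ∪ S) ({s(b, d)} ∪ M₁) := (IsPMOn.pair hdb.symm).union hM₁ hd1
    have hd2 : Disjoint ({a, c} : Finset (Fin n)) ({b, d} ∪ S) := by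
      rw [Finset.disjoint_union_right]
      refine ⟨?_, ?_⟩
      · rw [Finset.disjoint_left]; intro x hx
        simp only [Finset.mem_insert, Finset.mem_singleton] at hx ⊢
        rcases hx with rfl | rfl
        · exact fun h => h.elim hab hda.symm
        · exact fun h => h.elim hcb hdc.symm
      · rw [hS, Finset.disjoint_left]; intro x hx
        simp only [Finset.mem_insert, Finset.mem_singleton] at hx
        rcases hx with rfl | rfl <;> simp
    have hM : IsPMOn ({a, c} ∪ ({b, d} ∪ S)) ({s(a, c)} ∪ ({s(b, d)} ∪ M₁)) :=
      (IsPMOn.pair hca.symm).union hbdS hd2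
    have hU : ({a, c} ∪ ({b, d} ∪ S) : Finset (Fin n)) = Finset.univ := by
      ext x
      simp only [Finset.mem_union, Finset.mem_insert, Finset.mem_singleton, hS, Finset.mem_sdiff,
        Finset.mem_univ, true_and, iff_true]
      tauto
    rw [hU] at hM
    refine ⟨⟨_, hM⟩, fun hmem => ?_⟩
    -- `ab` is not an edge of this matching: the edge at `a` is `ac`
    have huniq := hM.unique (v := a) (Finset.mem_union_left _ (Finset.mem_singleton_self _)) hmem
      (Sym2.mem_mk_left a c) (Sym2.mem_mk_left a b)
    have : c = b := by
      have h := Sym2.congr_right.mp huniq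
      exact h
    exact hcb this

/-- **`max f_{E ∖ e} = n/2`** for `n ≥ 4`: some perfect matching avoids `e`. [cite: BraunEtAl2016, §4 (p. 7)] -/
theorem pmMax_allButEdge (h4 : 4 ≤ n) (M₀ : PMatch n) (e : Edge n) :
    pmMax (allButEdge e) = (n : ℝ) / 2 := by
  obtain ⟨M, hM⟩ := exists_pmatch_not_mem h4 M₀ e
  apply le_antisymm
  · refine csSup_le ⟨_, ⟨M, rfl⟩⟩ ?_
    rintro _ ⟨M', rfl⟩
    rw [pmVal_allButEdge, pmVec_apply]
    split_ifs <;> linarith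
  · refine le_csSup (Set.finite_range _).bddAbove ⟨M, ?_⟩
    rw [pmVal_allButEdge, pmVec_apply, if_neg hM, sub_zero]

/-- The slack of the objective `f_{E ∖ e}` at `M` is the edge row of Edmonds' slack matrix:
`C̃(f_{E∖e}) − f_{E∖e}(M) = χ_M(e)`. [cite: BraunEtAl2016, §4 (p. 7), §4.5 (p. 9)] -/
theorem pmSlack_allButEdge (h4 : 4 ≤ n) (e : Edge n) (M : PMatch n) :
    (pmProblem n 0).C (allButEdge e) - (pmProblem n 0).val (allButEdge e) M = pmVec n M e := by
  change pmMax (allButEdge e) + 0 / 2 - pmVal (allButEdge e) M = _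
  rw [pmMax_allButEdge h4 M e, pmVal_allButEdge]
  ring


/-- **An exact SDP formulation of `PM_n` factorizes Edmonds' FULL slack matrix.** A size-`d` SDP
formulation (Definition 2.2, `ε = 0`) of the perfect matching problem on `K_n`, `n ≥ 4`, yields a psd
factorization of size `d` of `pmFullSlack n`: the odd-cut rows from the objectives `f_{E[U]}` (the
tree's `SDPFormulation.exists_hasPsdFactorization_pmOddCutSlack`), the edge rows from the objectives
`f_{E ∖ e}` (`pmSlack_allButEdge`), all with the formulation's own column factors `X^M`.
[cite: BraunEtAl2016, Lemma 2.3 (p. 5), §4.5 (p. 9)] [cite: BraunPokuttaZink2015, Thm. (SDP factorization)] -/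
theorem hasPsdFactorization_pmFullSlack_of_sdpFormulation (h4 : 4 ≤ n) {d : ℕ}
    (E : SDPFormulation (pmProblem n 0) d) : HasPsdFactorization (pmFullSlack n) d := by
  classical
  rcases isEmpty_or_nonempty (PMatch n) with hE | hne
  · exact ⟨fun _ => 0, fun _ => 0, fun _ => PosSemidef.zero, fun _ => PosSemidef.zero,
      fun _ M => hE.elim M⟩
  obtain ⟨A, hA, hodd⟩ := E.exists_hasPsdFactorization_pmOddCutSlack
  choose Ue hUe hedge using fun e : Edge n =>
    E.exists_posSemidef_slack_of_attained (pmProblem_sound 0 (allButEdge e))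
      (pmProblem_attained (allButEdge e))
  refine ⟨Sum.elim A Ue, E.X, ?_, E.posSemidef_X, ?_⟩
  · rintro (U | e)
    · exact hA U
    · exact hUe e
  · rintro (U | e) M
    · exact hodd U M
    · rw [Sum.elim_inr, pmFullSlack_inr, ← pmSlack_allButEdge h4 e M]
      exact hedge e M

/-- **Exact SDP formulations of the perfect matching problem have size at least `C(n,2) − n + 1`.**
For even `n ≥ 4`, every SDP formulation (Braun et al. Definition 2.2, exact: `ε = 0`) of `PM_n` has
size `d ≥ C(n,2) − n + 1 = dim P_PM(K_n) + 1` — the Gouveia–Robinson–Thomas dimension bound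
(`choose_two_sub_add_one_le_of_hasPsdFactorization`) read through the factorization theorem. No
symmetry assumption; compare the exponential bound for SYMMETRIC formulations
(`BraunEtAl2016_symmetricSDP_matching_holds`) and the open general question.
[cite: GouveiaRobinsonThomas2013, Prop. 3.2 (p07)] [cite: FawziEtAl2015, Cor. 5.9 (p15)]
[cite: BraunEtAl2016, Lemma 2.3 (p. 5), §1 (p. 3)] -/
theorem choose_two_sub_add_one_le_sdp_size (hn : Even n) (h4 : 4 ≤ n) {d : ℕ}
    (E : SDPFormulation (pmProblem n 0) d) : n.choose 2 - n + 1 ≤ d :=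
  choose_two_sub_add_one_le_of_hasPsdFactorization hn h4
    (hasPsdFactorization_pmFullSlack_of_sdpFormulation h4 E)

/-- Contrapositive: **no exact SDP formulation of `PM_n` of size `≤ C(n,2) − n`** (`n ≥ 4` even).
[cite: GouveiaRobinsonThomas2013, Prop. 3.2 (p07)] [cite: BraunEtAl2016, Lemma 2.3 (p. 5)] -/
theorem isEmpty_sdpFormulation_pmProblem (hn : Even n) (h4 : 4 ≤ n) {d : ℕ} (hd : d ≤ n.choose 2 - n) :
    IsEmpty (SDPFormulation (pmProblem n 0) d) :=
  ⟨fun E => absurd (choose_two_sub_add_one_le_sdp_size hn h4 E) (by omega)⟩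

end PMPolytopeDim

end Literature.Combinatorics.Optimization

end
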